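import Summits.ResolutionOfSingularities.ResolutionOfSingularities.Theorems.FrobeniusClosingSteerRsopMonomialStep
import Summits.ResolutionOfSingularities.ResolutionOfSingularities.Theorems.FrobeniusClosingSteerSwitchPlaneChart
import Literature.AlgebraicGeometry.Resolution.QuadraticTransforms
import HarnessLib

/-!
# hARᵒ H2 — F3w: ADAPTED RATIONAL WINDOWS of a quadratic transform along a valuation
# (the coordinate data consumed by res-type-028's window kernel and by F1/F2/F3; Theses-free, def-free)

OURS (campaign `res-hironaka`, rung L ★L-G4, slot W4.1 · crux `Steer` (stmt-ResolutionOfSingularities-16345) · hARᵒ slot H2; res-type-062 g15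
`H2-DESIGN.md` v1 §3 F3). Over the tree's `exists_isRsopPart_quadraticTransform_rsopStep` (`…SteerRsopMonomialStep`: `(x, (w_j/x)_j)` is part of a
regular system of parameters of the transform; HLOST Lemma 2.7 / de Jong 2.4 / Stacks 0BIQ). Not a statement of the manuscript under review
[claim: Hironaka2017, status: under-review]; AI-produced, weaker than expert review.

THE SETTING. `R ⊆ K` regular local of dimension `n + 1` dominated by the valuation ring `O`, `x ∈ 𝔪_R` non-zero of maximal value (an exceptional
parameter), `R₁ = (R[𝔪/x])_{𝔪_O ∩ R[𝔪/x]}` the quadratic transform along `O` (regular local of dimension `n + 1`, dominated by `O`), and the window is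
RATIONAL: every residue class of `R₁` has a representative in `R`.

* `span_range_eq_of_isRsopPart_of_ringKrullDim` — a part of a regular system of parameters with as many members as the dimension generates `𝔪`.
* `exists_adapted_of_rsop` — CORE: if `(x, w₁, …, w_n)` generates `𝔪_R` and every `w_j/x` lies in `𝔪_{R₁}`, then `𝔪_{R₁} = (x, w₁/x, …, w_n/x)`.
* **`exists_adapted_window`** — with rationality: there are `u : Fin n → R`, `u' : Fin n → R₁` with `𝔪_R = (x, u)`, `u_j = x·u'_j`, `𝔪_{R₁} = (x, u')`
  (translate any regular system `(x, y)` by constants: `u_j = y_j − c_j x` with `y_j/x ≡ c_j (mod 𝔪_{R₁})`).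
* **`exists_adapted_window_cons`** — the same with ONE PRESCRIBED adapted parameter `p`: if `p ∈ 𝔪_R` with `p/x ∈ 𝔪_{R₁}` (the SATELLITE condition of
  F3: `p = x_A`, the old divisor, whose strict transform passes through the new centre), then the adapted system can be chosen with `u₀ = p`
  (`(x, p)` is part of a regular system: `p ∉ 𝔪² + (x)` because `p/x` is not a unit, `SwitchPlane.isRsopPart_pair`).
[cite: DeJong1996, 2.4] [cite: StacksProject, Tag 0BIQ] [cite: Matsumura1987, Thm. 14.2]
-/

noncomputable section

-- `Summit.<S>.<S>.…` duplicates the summit name by design (single-problem summit).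
set_option linter.dupNamespace false

open IsLocalRing

namespace Summit.ResolutionOfSingularities.ResolutionOfSingularities.Theorems.SwitchingDichotomy.BinaryResidue

open Literature.AlgebraicGeometry.Resolution

variable {K : Type} [Field K]

/-! ## §1 Full regular systems -/

/-- A part of a regular system of parameters with `dim R` members generates the maximal ideal. [cite: Matsumura1987, Thm. 14.2] -/
theorem span_range_eq_of_isRsopPart_of_ringKrullDim {A : Type} [CommRing A] [IsLocalRing A] {m : ℕ} {z : Fin m → A}
    (hz : IsRsopPart z) (hdim : ringKrullDim A = (m : ℕ)) : Ideal.span (Set.range z) = maximalIdeal A := by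
  obtain ⟨_, e, y, hd, hspan⟩ := hz
  rw [hdim] at hd
  have he : e = 0 := by
    have : (m : ℕ) = m + e := by exact_mod_cast hd
    omega
  subst he
  rw [Set.range_eq_empty y, Set.union_empty] at hspan
  exact hspan

/-! ## §2 Adapted coordinates on a quadratic transform -/

section window

variable {O : ValuationSubring K} {R R₁ : Subring K} [IsRegularLocalRing R] [IsLocalRing R₁]

/-- **CORE.** If `(x, w₁, …, w_n)` generates `𝔪_R` (`R` regular of dimension `n + 1`, dominated by `O`, `x ≠ 0` of maximal value) and every `w_j/x`
has value `< 1`, then on the transform `R₁ = (R[𝔪/x])_{𝔪_O ∩ R[𝔪/x]}` (of dimension `n + 1`) the elements `u'_j := w_j/x` lie in `R₁`, and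
`𝔪_{R₁} = (x, u'₁, …, u'_n)`. [cite: DeJong1996, 2.4] [cite: StacksProject, Tag 0BIQ] -/
theorem exists_adapted_of_rsop (hdom : SubringDominates R O.toSubring) {n : ℕ} (hdimR : ringKrullDim R = (n + 1 : ℕ))
    (x : R) (hx0 : (x : K) ≠ 0) (hxmax : ∀ y : R, y ∈ maximalIdeal R → O.valuation (y : K) ≤ O.valuation (x : K))
    (w : Fin n → R) (hxw : Ideal.span (insert x (Set.range w)) = maximalIdeal R)
    (hR₁ : R₁ = locAtCentre (blowupRing R (x : K)) O) (hle : R ≤ R₁) (hdim₁ : ringKrullDim R₁ = (n + 1 : ℕ))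
    (hw : ∀ j, O.valuation (((w j : R) : K) / (x : K)) < 1) :
    ∃ u' : Fin n → R₁, (∀ j, ((w j : R) : K) = (x : K) * ((u' j : R₁) : K)) ∧
      Ideal.span (insert (⟨(x : K), hle x.2⟩ : R₁) (Set.range u')) = maximalIdeal R₁ := by
  classical
  have hd : (maximalIdeal R).spanFinrank = n + 1 := by
    have h := IsRegularLocalRing.spanFinrank_maximalIdeal (R := R)
    rw [hdimR] at h
    exact_mod_cast h
  set xw : Fin (n + 1) → R := Fin.cons x w with hxwdef
  have hspan : Ideal.span (Set.range xw) = maximalIdeal R := by rw [hxwdef, Fin.range_cons, hxw]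
  have hmin : ∀ j, O.valuation ((xw j : R) : K) ≤ O.valuation ((xw 0 : R) : K) := by
    intro j
    refine Fin.cases (le_refl _) (fun k => ?_) j
    simp only [hxwdef, Fin.cons_succ, Fin.cons_zero]
    exact hxmax _ (hxw ▸ Ideal.subset_span (Set.mem_insert_of_mem _ ⟨k, rfl⟩))
  have hxi : ((xw 0 : R) : K) ≠ 0 := by simpa [hxwdef] using hx0
  set jJ : Fin n → {j : Fin (n + 1) // j ≠ 0} := fun k => ⟨k.succ, Fin.succ_ne_zero k⟩ with hjJ
  have hjJinj : Function.Injective jJ := fun a b h => Fin.succ_injective _ (congrArg Subtype.val h)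
  have hJ : ∀ k, O.valuation (((xw (jJ k).1 : R) : K) / ((xw 0 : R) : K)) < 1 := fun k => by
    simpa [hxwdef, hjJ] using hw k
  obtain ⟨z₁, hz₁, hz₁0, hz₁s⟩ :=
    exists_isRsopPart_quadraticTransform_rsopStep R O hdom hd xw hspan 0 hxi hmin jJ hjJinj hJ R₁ hR₁
  refine ⟨fun k => z₁ k.succ, fun k => ?_, ?_⟩
  · have h := hz₁s k
    simp only [hxwdef, hjJ, Fin.cons_succ, Fin.cons_zero] at h
    rw [h, mul_div_cancel₀ _ hx0]
  · have hfull := span_range_eq_of_isRsopPart_of_ringKrullDim hz₁ hdim₁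
    have hz₁0' : z₁ 0 = ⟨(x : K), hle x.2⟩ := Subtype.ext (by rw [hz₁0]; simp [hxwdef])
    rw [← hfull, ← hz₁0', ← Fin.range_cons]
    congr 1
    ext a
    constructor
    · rintro ⟨i, rfl⟩
      exact ⟨i, by refine Fin.cases ?_ (fun k => ?_) i <;> simp⟩
    · rintro ⟨i, rfl⟩
      exact ⟨i, by refine Fin.cases ?_ (fun k => ?_) i <;> simp⟩

/-- Translation by constants: in a RATIONAL window every `y ∈ 𝔪_R` has a constant `c ∈ R` with `(y − c·x)/x ∈ 𝔪_{R₁}` (value `< 1`).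
[folklore] -/
theorem exists_translate (hdom₁ : SubringDominates R₁ O.toSubring) (x : R) (hx0 : (x : K) ≠ 0)
    (hR₁ : R₁ = locAtCentre (blowupRing R (x : K)) O) (hle : R ≤ R₁)
    (hrat : ∀ a : R₁, ∃ b : R, a - ⟨(b : K), hle b.2⟩ ∈ maximalIdeal R₁) {m : ℕ} (y : Fin m → R)
    (hym : ∀ i, y i ∈ maximalIdeal R) :
    ∃ c : Fin m → R, ∀ i, O.valuation (((y i - c i * x : R) : K) / (x : K)) < 1 := by
  have hB : blowupRing R (x : K) ≤ R₁ := hR₁ ▸ le_locAtCentre _ O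
  have hval₁ : ∀ a : R₁, a ∈ maximalIdeal R₁ ↔ O.valuation (a : K) < 1 :=
    (subringDominates_valuationSubring_iff hdom₁.1).mp hdom₁
  have hydiv : ∀ i, ((y i : R) : K) / (x : K) ∈ R₁ := fun i => hB (div_mem_blowupRing _ (hym i))
  choose c hc using fun i => hrat ⟨_, hydiv i⟩
  refine ⟨c, fun i => ?_⟩
  have h := (hval₁ _).mp (hc i)
  have e1 : ((y i - c i * x : R) : K) / (x : K) = ((y i : R) : K) / (x : K) - ((c i : R) : K) := by
    push_cast
    field_simp
  rw [e1]
  exact h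

/-- **ADAPTED RATIONAL WINDOW.** `R` regular local of dimension `n + 1` dominated by `O`, `x ∈ 𝔪_R` non-zero of maximal value, `R₁` the quadratic
transform along `O` (dimension `n + 1`, dominated by `O`), RATIONAL over `R`. Then `𝔪_R = (x, u)` and `𝔪_{R₁} = (x, u')` with `u_j = x·u'_j`.
[cite: DeJong1996, 2.4] [cite: Matsumura1987, Thm. 14.2] -/
theorem exists_adapted_window (hdom : SubringDominates R O.toSubring) (hdom₁ : SubringDominates R₁ O.toSubring) {n : ℕ}
    (hdimR : ringKrullDim R = (n + 1 : ℕ)) (x : R) (hxm : x ∈ maximalIdeal R) (hx0 : (x : K) ≠ 0)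
    (hxmax : ∀ y : R, y ∈ maximalIdeal R → O.valuation (y : K) ≤ O.valuation (x : K))
    (hR₁ : R₁ = locAtCentre (blowupRing R (x : K)) O) (hle : R ≤ R₁) (hdim₁ : ringKrullDim R₁ = (n + 1 : ℕ))
    (hrat : ∀ a : R₁, ∃ b : R, a - ⟨(b : K), hle b.2⟩ ∈ maximalIdeal R₁) :
    ∃ (u : Fin n → R) (u' : Fin n → R₁), Ideal.span (insert x (Set.range u)) = maximalIdeal R ∧
      (∀ j, ((u j : R) : K) = (x : K) * ((u' j : R₁) : K)) ∧
      Ideal.span (insert (⟨(x : K), hle x.2⟩ : R₁) (Set.range u')) = maximalIdeal R₁ := by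
  classical
  -- `x` is a regular parameter; extend to a regular system `(x, y)`
  have hx2 : x ∉ maximalIdeal R ^ 2 := fun h =>
    (lt_irrefl _) (SwitchPlane.valuation_lt_of_mem_sq hdom hx0 hxmax h)
  obtain ⟨e, y, hd, hspan, hxy⟩ := (SwitchPlane.isRsopPart_singleton hxm hx2).exists_rsop
  have hdR : (maximalIdeal R).spanFinrank = n + 1 := by
    have h := IsRegularLocalRing.spanFinrank_maximalIdeal (R := R)
    rw [hdimR] at h
    exact_mod_cast h
  have hen : e = n := by omega
  subst hen
  have hym : ∀ i, y i ∈ maximalIdeal R := fun i => hspan ▸ Ideal.subset_span ⟨i, rfl⟩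
  have hy0 : y (Fin.castAdd e 0) = x := by simpa using hxy 0
  -- translate the other members
  obtain ⟨c, hc⟩ := exists_translate hdom₁ x hx0 hR₁ hle hrat (fun k : Fin e => y (Fin.natAdd 1 k)) (fun k => hym _)
  set u : Fin e → R := fun k => y (Fin.natAdd 1 k) - c k * x with hu
  -- `(x, u)` still generates `𝔪_R`
  have hxu : Ideal.span (insert x (Set.range u)) = maximalIdeal R := by
    rw [← hspan]
    apply le_antisymm
    · rw [Ideal.span_le]
      rintro a (rfl | ⟨k, rfl⟩)
      · rw [SetLike.mem_coe, ← hy0]; exact Ideal.subset_span ⟨_, rfl⟩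
      · exact sub_mem (Ideal.subset_span ⟨_, rfl⟩) (Ideal.mul_mem_left _ _ (hy0 ▸ Ideal.subset_span ⟨_, rfl⟩))
    · rw [Ideal.span_le]
      rintro a ⟨i, rfl⟩
      rw [SetLike.mem_coe]
      induction i using Fin.addCases with
      | left i0 =>
        have : i0 = 0 := Fin.eq_zero i0
        subst this
        rw [hy0]
        exact Ideal.subset_span (Set.mem_insert _ _)
      | right k =>
        have e1 : y (Fin.natAdd 1 k) = u k + c k * x := by simp [hu]
        rw [e1]
        exact add_mem (Ideal.subset_span (Set.mem_insert_of_mem _ ⟨k, rfl⟩))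
          (Ideal.mul_mem_left _ _ (Ideal.subset_span (Set.mem_insert _ _)))
  obtain ⟨u', hu', hm'⟩ := exists_adapted_of_rsop hdom hdimR x hx0 hxmax u hxu hR₁ hle hdim₁ hc
  exact ⟨u, u', hxu, hu', hm'⟩

/-- In a window, `p ∈ 𝔪_R ∖ 𝔪_R²` whose transform `p/x` is NOT a unit of `R₁` is independent of `x` modulo `𝔪_R²`: `(x, p)` is part of a regular
system of parameters of `R` (else `p = m + c·x` with `m ∈ 𝔪²`, `c` a unit, and `p/x = m/x + c` is a unit of `R₁`). [cite: Matsumura1987, Thm. 14.2] -/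
theorem isRsopPart_pair_of_div_mem_maximalIdeal (hdom : SubringDominates R O.toSubring) (hdom₁ : SubringDominates R₁ O.toSubring)
    (x : R) (hxm : x ∈ maximalIdeal R) (hx0 : (x : K) ≠ 0)
    (hxmax : ∀ y : R, y ∈ maximalIdeal R → O.valuation (y : K) ≤ O.valuation (x : K))
    (hR₁ : R₁ = locAtCentre (blowupRing R (x : K)) O) (hle : R ≤ R₁)
    (p : R) (hpm : p ∈ maximalIdeal R) (hp2 : p ∉ maximalIdeal R ^ 2)
    (hpx : ∃ h : (p : K) / (x : K) ∈ R₁, (⟨(p : K) / (x : K), h⟩ : R₁) ∈ maximalIdeal R₁) :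
    IsRsopPart ![x, p] := by
  classical
  have hx2 : x ∉ maximalIdeal R ^ 2 := fun h =>
    (lt_irrefl _) (SwitchPlane.valuation_lt_of_mem_sq hdom hx0 hxmax h)
  have hB : blowupRing R (x : K) ≤ R₁ := hR₁ ▸ le_locAtCentre _ O
  have hval₁ : ∀ a : R₁, a ∈ maximalIdeal R₁ ↔ O.valuation (a : K) < 1 :=
    (subringDominates_valuationSubring_iff hdom₁.1).mp hdom₁
  obtain ⟨hpxR, hpxm⟩ := hpx
  refine SwitchPlane.isRsopPart_pair hxm hx2 hpm fun h => ?_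
  obtain ⟨m, hm, w, hw, hmw⟩ := Submodule.mem_sup.mp h
  obtain ⟨c, hc⟩ := Ideal.mem_span_singleton'.mp hw
  by_cases hcm : c ∈ maximalIdeal R
  · apply hp2
    rw [← hmw, ← hc, pow_two]
    exact add_mem (by rw [← pow_two]; exact hm) (Ideal.mul_mem_mul hcm hxm)
  · have hcu : IsUnit c := IsLocalRing.notMem_maximalIdeal.mp hcm
    have hmx : (⟨((m : R) : K) / (x : K), hB (div_mem_blowupRing _ (Ideal.pow_le_self two_ne_zero hm))⟩ : R₁) ∈
        maximalIdeal R₁ := by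
      rw [hval₁]
      have hlt := SwitchPlane.valuation_lt_of_mem_sq hdom hx0 hxmax hm
      have hvx : O.valuation (x : K) ≠ 0 := (map_ne_zero _).mpr hx0
      change O.valuation (((m : R) : K) / (x : K)) < 1
      rw [map_div₀]
      exact (div_lt_one₀ (pos_iff_ne_zero.mpr hvx)).mpr hlt
    have hcunit : IsUnit (⟨(c : K), hle c.2⟩ : R₁) := hcu.map (Subring.inclusion hle)
    have e1 : (⟨(p : K) / (x : K), hpxR⟩ : R₁) -
        ⟨((m : R) : K) / (x : K), hB (div_mem_blowupRing _ (Ideal.pow_le_self two_ne_zero hm))⟩ = ⟨(c : K), hle c.2⟩ := by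
      apply Subtype.ext
      have : (p : K) = (m : K) + (c : K) * (x : K) := by
        have := congrArg Subtype.val hmw
        rw [← hc] at this
        push_cast at this
        linear_combination -this
      change (p : K) / (x : K) - ((m : R) : K) / (x : K) = (c : K)
      rw [this]
      field_simp
      ring
    have hmem : (⟨(c : K), hle c.2⟩ : R₁) ∈ maximalIdeal R₁ := by rw [← e1]; exact sub_mem hpxm hmx
    exact (IsLocalRing.mem_maximalIdeal _).mp hmem hcunit

/-- **ADAPTED RATIONAL WINDOW WITH A PRESCRIBED PARAMETER (the satellite configuration).** As `exists_adapted_window`, with moreover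
`p ∈ 𝔪_R ∖ 𝔪_R²` such that `p/x ∈ 𝔪_{R₁}` (the strict transform of `V(p)` passes through the centre of `R₁`): the adapted system may be chosen with
`u₀ = p`. [cite: DeJong1996, 2.4] [cite: Matsumura1987, Thm. 14.2] -/
theorem exists_adapted_window_cons (hdom : SubringDominates R O.toSubring) (hdom₁ : SubringDominates R₁ O.toSubring) {n : ℕ}
    (hdimR : ringKrullDim R = (n + 1 + 1 : ℕ)) (x : R) (hxm : x ∈ maximalIdeal R) (hx0 : (x : K) ≠ 0)
    (hxmax : ∀ y : R, y ∈ maximalIdeal R → O.valuation (y : K) ≤ O.valuation (x : K))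
    (hR₁ : R₁ = locAtCentre (blowupRing R (x : K)) O) (hle : R ≤ R₁) (hdim₁ : ringKrullDim R₁ = (n + 1 + 1 : ℕ))
    (hrat : ∀ a : R₁, ∃ b : R, a - ⟨(b : K), hle b.2⟩ ∈ maximalIdeal R₁)
    (p : R) (hpm : p ∈ maximalIdeal R) (hp2 : p ∉ maximalIdeal R ^ 2)
    (hpx : ∃ h : (p : K) / (x : K) ∈ R₁, (⟨(p : K) / (x : K), h⟩ : R₁) ∈ maximalIdeal R₁) :
    ∃ (u : Fin (n + 1) → R) (u' : Fin (n + 1) → R₁), u 0 = p ∧ Ideal.span (insert x (Set.range u)) = maximalIdeal R ∧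
      (∀ j, ((u j : R) : K) = (x : K) * ((u' j : R₁) : K)) ∧
      Ideal.span (insert (⟨(x : K), hle x.2⟩ : R₁) (Set.range u')) = maximalIdeal R₁ := by
  classical
  have hval₁ : ∀ a : R₁, a ∈ maximalIdeal R₁ ↔ O.valuation (a : K) < 1 :=
    (subringDominates_valuationSubring_iff hdom₁.1).mp hdom₁
  have hpair := isRsopPart_pair_of_div_mem_maximalIdeal hdom hdom₁ x hxm hx0 hxmax hR₁ hle p hpm hp2 hpx
  obtain ⟨e, y, hd, hspan, hxy⟩ := hpair.exists_rsop
  have hdR : (maximalIdeal R).spanFinrank = n + 1 + 1 := by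
    have h := IsRegularLocalRing.spanFinrank_maximalIdeal (R := R)
    rw [hdimR] at h
    exact_mod_cast h
  have hen : e = n := by omega
  subst hen
  have hym : ∀ i, y i ∈ maximalIdeal R := fun i => hspan ▸ Ideal.subset_span ⟨i, rfl⟩
  have hy0 : y (Fin.castAdd e 0) = x := by simpa using hxy 0
  have hy1 : y (Fin.castAdd e 1) = p := by simpa using hxy 1
  obtain ⟨c, hc⟩ := exists_translate hdom₁ x hx0 hR₁ hle hrat (fun k : Fin e => y (Fin.natAdd 2 k)) (fun k => hym _)
  set u : Fin (e + 1) → R := Fin.cons p (fun k => y (Fin.natAdd 2 k) - c k * x) with hu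
  have hw : ∀ j, O.valuation (((u j : R) : K) / (x : K)) < 1 := by
    intro j
    refine Fin.cases ?_ (fun k => ?_) j
    · simp only [hu, Fin.cons_zero]
      obtain ⟨hpxR, hpxm⟩ := hpx
      exact (hval₁ _).mp hpxm
    · simp only [hu, Fin.cons_succ]
      exact hc k
  have hxu : Ideal.span (insert x (Set.range u)) = maximalIdeal R := by
    rw [← hspan]
    apply le_antisymm
    · rw [Ideal.span_le]
      rintro a (rfl | ⟨j, rfl⟩)
      · rw [SetLike.mem_coe, ← hy0]; exact Ideal.subset_span ⟨_, rfl⟩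
      · rw [SetLike.mem_coe]
        refine Fin.cases ?_ (fun k => ?_) j
        · rw [hu, Fin.cons_zero, ← hy1]; exact Ideal.subset_span ⟨_, rfl⟩
        · rw [hu, Fin.cons_succ]
          exact sub_mem (Ideal.subset_span ⟨_, rfl⟩) (Ideal.mul_mem_left _ _ (hy0 ▸ Ideal.subset_span ⟨_, rfl⟩))
    · rw [Ideal.span_le]
      rintro a ⟨i, rfl⟩
      rw [SetLike.mem_coe]
      induction i using Fin.addCases with
      | left i0 =>
        refine Fin.cases ?_ (fun i1 => ?_) i0
        · rw [hy0]; exact Ideal.subset_span (Set.mem_insert _ _)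
        · have : i1 = 0 := Fin.eq_zero i1
          subst this
          rw [show Fin.succ (0 : Fin 1) = (1 : Fin 2) from rfl, hy1]
          refine Ideal.subset_span (Set.mem_insert_of_mem _ ⟨0, ?_⟩)
          rw [hu, Fin.cons_zero]
      | right k =>
        have e1 : y (Fin.natAdd 2 k) = u k.succ + c k * x := by simp [hu]
        rw [e1]
        exact add_mem (Ideal.subset_span (Set.mem_insert_of_mem _ ⟨k.succ, rfl⟩))
          (Ideal.mul_mem_left _ _ (Ideal.subset_span (Set.mem_insert _ _)))
  obtain ⟨u', hu', hm'⟩ := exists_adapted_of_rsop hdom hdimR x hx0 hxmax u hxu hR₁ hle hdim₁ hw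
  exact ⟨u, u', by rw [hu, Fin.cons_zero], hxu, hu', hm'⟩

end window

end Summit.ResolutionOfSingularities.ResolutionOfSingularities.Theorems.SwitchingDichotomy.BinaryResidue

end
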